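import Summits.BirchSwinnertonDyer.BirchSwinnertonDyer.Theses.PrintCFram
import HarnessLib

/-!
# Route `PrintCFram`: the GLUE `CMRamifiedThreeBSDOfRegimes` of the tenure split of C1 holds
# (item stmt-BirchSwinnertonDyer-20701; cell `bsd-print-cfram`, seat ty2 gen 2 = the cell's
# discharge-interface typer — planner/referee TURNKEY «p4 or ty2: land the glue BY NAME»; filed in the
# cell's `Rank1Residual/PrintCfram/` folder next to p2's `RubinRoadFiveLe.lean` because
# `Summits/…/Theorems/` is prover-only (D-0016) for a literature-prover seat; the item is then closed
# `ledger workitem close stmt-BirchSwinnertonDyer-20701 --as proved --by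
# Summit.BirchSwinnertonDyer.Rank1Residual.PrintCfram.cmRamifiedThreeBSDOfRegimes_holds`)

HONEST FRAMING (cell `bsd-print-cfram`, run/shared/lean/pub/bsd-print-cfram/, D-0131 (2) print tier):
the cell works the partition leaf `CornerF ∧ p ramified in the CM field K` in PARTITION currency — a
leaf counts only when its class theorem is in the kernel BY NAME, flag-free. This file is GLUE ONLY:
it proves the route declaration
`Summit.BirchSwinnertonDyer.BirchSwinnertonDyer.Theses.PrintCFram.CMRamifiedThreeBSDOfRegimes`
(= `TorsionFreeFrameBSDThree → LocalThreeTorsionBSDThree → SplitPlaceTorsionBSDThree →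
CMRamifiedThreeBSD`, route rev 6, gen-1 split of C1 = stmt-…-20371 into the regimes N = stmt-…-20698,
T = stmt-…-20699, V = stmt-…-20700) BY NAME, exactly as sketched by the planner
(HOME/plan/SplitSketch.lean, `CMRamifiedThreeBSD_of_regimes`) and independently by the referee
(item evidence `GlueProof.lean` on 20701). No regime is proved here; nothing is asserted about any
curve; no named fact is introduced; 0 cells move; beyond-print theorem: NO.

THE ARGUMENT. At every CM curve `W/ℚ` with `3` ramified in its CM field a `3`-frame
`X12.O11.IsFrameThree W K 𝔭 W' C` exists (`K = ℚ(√−3)`, `𝔭 ∋ 3`, `W' = C • W^{(d_K)}` globally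
minimal): `Summit.BirchSwinnertonDyer.Rank1Residual.X12.O11.exists_isFrameThree_of_cmRamified`
(ty2 gen 1, `X12/O11/RamifiedStrictDescentAtThreeLocal.lean`). The three regimes are the classical
case split on the frame's two DISPLAYED local inputs: (A𝔭)₃ «no non-zero `ℚ₃`-rational `3`-torsion on
`W` and on `W'`» and (Av)₃ «at every degree-one place `v ∤ 3` of `K`, good reduction or no non-zero
`K_v`-rational `3`-torsion». N = (A𝔭)₃ ∧ (Av)₃, T = ¬(A𝔭)₃, V = (A𝔭)₃ ∧ ¬(Av)₃; so N ∧ T ∧ V ⟹ C1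
by `by_cases`, and conversely each regime is a restriction of C1 (§2, so the split is an
EQUIVALENCE and no child is stronger than the parent).

References: route file `Theses/PrintCFram.lean` (rev 6; items 20698–20701); HOME/plan/SplitSketch.lean;
HOME/REFEREE.md A27; HOME/TY2-DISCHARGE-TABLE.md §C; [cite: GreenbergLNM1716, §3 Lemma 3.3 (the local
kernel at a finitely decomposed bad place has order the `p`-part of the Tamagawa number — the print
behind the (Av)₃ input)]; [cite: Miller2011LMS, §1 and Def. 1.1 (`BSDp`)].
-/

set_option autoImplicit false

namespace Summit.BirchSwinnertonDyer.Rank1Residual.PrintCfram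

open Summit.BirchSwinnertonDyer.BirchSwinnertonDyer.Theses.PrintCFram

/-! ## §1 The glue BY NAME -/

/-- **GLUE of the tenure split of C1 (item stmt-BirchSwinnertonDyer-20701) — PROVED.**
`TorsionFreeFrameBSDThree → LocalThreeTorsionBSDThree → SplitPlaceTorsionBSDThree →
CMRamifiedThreeBSD`: given the three regime statements and C1's four refereed antecedents, take a
globally minimal CM curve `W/ℚ` of analytic rank one with `3` ramified in its CM field; a `3`-frame
`(K, 𝔭, W', C)` exists (`X12.O11.exists_isFrameThree_of_cmRamified`); case on (A𝔭)₃ for `W`, then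
for `W'`, then on (Av)₃: all three hold ⟹ regime N; (A𝔭)₃ fails on `W` or on `W'` ⟹ regime T;
(A𝔭)₃ holds and (Av)₃ fails ⟹ regime V. The type is literally the route declaration. -/
theorem cmRamifiedThreeBSDOfRegimes_holds :
    Summit.BirchSwinnertonDyer.BirchSwinnertonDyer.Theses.PrintCFram.CMRamifiedThreeBSDOfRegimes := by
  intro hN hT hV hmod hGZ hGZK hCassels W _ _ hCM hr hram
  obtain ⟨K, _, _, 𝔭, W', _, _, C, hF⟩ :=
    Summit.BirchSwinnertonDyer.Rank1Residual.X12.O11.exists_isFrameThree_of_cmRamified W hCM hram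
  by_cases htors : ∀ Q : (W.baseChange ℚ_[3]).toAffine.Point, (3 : ℕ) • Q = 0 → Q = 0
  · by_cases htors' : ∀ Q : (W'.baseChange ℚ_[3]).toAffine.Point, (3 : ℕ) • Q = 0 → Q = 0
    · by_cases hv : ∀ v : IsDedekindDomain.HeightOneSpectrum (NumberField.RingOfIntegers K),
          ((3 : ℕ) : NumberField.RingOfIntegers K) ∉ v.asIdeal →
          v.asIdeal.ramificationIdx (NumberField.RingOfIntegers ℚ) = 1 →
          v.asIdeal.inertiaDeg (NumberField.RingOfIntegers ℚ) = 1 →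
          (W.baseChange K).HasGoodReductionAt v ∨
            ∀ R : ((W.baseChange K).baseChange (v.adicCompletion K)).toAffine.Point,
              (3 : ℕ) • R = 0 → R = 0
      · exact hN hmod hGZ hGZK hCassels W K 𝔭 W' C hF hr htors htors' hv
      · refine hV hmod hGZ hGZK hCassels W K 𝔭 W' C hF hr htors htors' ?_
        push Not at hv
        obtain ⟨v, h3, he, hf, hbad, R, hR, hR0⟩ := hv
        exact ⟨v, h3, he, hf, hbad, R, hR, hR0⟩
    · refine hT hmod hGZ hGZK hCassels W K 𝔭 W' C hF hr (Or.inr ?_)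
      push Not at htors'
      obtain ⟨Q, hQ, hQ0⟩ := htors'
      exact ⟨Q, hQ, hQ0⟩
  · refine hT hmod hGZ hGZK hCassels W K 𝔭 W' C hF hr (Or.inl ?_)
    push Not at htors
    obtain ⟨Q, hQ, hQ0⟩ := htors
    exact ⟨Q, hQ, hQ0⟩

/-- The glue in curried form under its sketch name: the three regimes imply C1. -/
theorem cmRamifiedThreeBSD_of_regimes (hN : TorsionFreeFrameBSDThree) (hT : LocalThreeTorsionBSDThree)
    (hV : SplitPlaceTorsionBSDThree) : CMRamifiedThreeBSD :=
  cmRamifiedThreeBSDOfRegimes_holds hN hT hV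

/-! ## §2 Converse bookkeeping: each regime is a restriction of C1 (the split is an equivalence) -/

/-- Regime N (`TorsionFreeFrameBSDThree`, stmt-…-20698) is implied by C1: a `3`-frame carries
`W.HasCM` and `CMRamified W 3` (`hF.1`, `hF.2.1`), and N only adds hypotheses. -/
theorem torsionFreeFrameBSDThree_of_cmRamifiedThreeBSD (h : CMRamifiedThreeBSD) :
    TorsionFreeFrameBSDThree :=
  fun hmod hGZ hGZK hCassels W _ _ _K _ _ _𝔭 _W' _ _ _C hF hr _ _ _ =>
    h hmod hGZ hGZK hCassels W hF.1 hr hF.2.1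

/-- Regime T (`LocalThreeTorsionBSDThree`, stmt-…-20699) is implied by C1. -/
theorem localThreeTorsionBSDThree_of_cmRamifiedThreeBSD (h : CMRamifiedThreeBSD) :
    LocalThreeTorsionBSDThree :=
  fun hmod hGZ hGZK hCassels W _ _ _K _ _ _𝔭 _W' _ _ _C hF hr _ =>
    h hmod hGZ hGZK hCassels W hF.1 hr hF.2.1

/-- Regime V (`SplitPlaceTorsionBSDThree`, stmt-…-20700) is implied by C1. -/
theorem splitPlaceTorsionBSDThree_of_cmRamifiedThreeBSD (h : CMRamifiedThreeBSD) :
    SplitPlaceTorsionBSDThree :=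
  fun hmod hGZ hGZK hCassels W _ _ _K _ _ _𝔭 _W' _ _ _C hF hr _ _ _ =>
    h hmod hGZ hGZK hCassels W hF.1 hr hF.2.1

/-- The split is an EQUIVALENCE: C1 ⟺ N ∧ T ∧ V. -/
theorem cmRamifiedThreeBSD_iff_regimes :
    CMRamifiedThreeBSD ↔
      TorsionFreeFrameBSDThree ∧ LocalThreeTorsionBSDThree ∧ SplitPlaceTorsionBSDThree :=
  ⟨fun h => ⟨torsionFreeFrameBSDThree_of_cmRamifiedThreeBSD h,
    localThreeTorsionBSDThree_of_cmRamifiedThreeBSD h, splitPlaceTorsionBSDThree_of_cmRamifiedThreeBSD h⟩,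
   fun h => cmRamifiedThreeBSDOfRegimes_holds h.1 h.2.1 h.2.2⟩

end Summit.BirchSwinnertonDyer.Rank1Residual.PrintCfram
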